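import Summits.AtomisticToContinuum.Crystallization.Theses.ReggeStarCoercivity
import Summits.AtomisticToContinuum.Crystallization.Theses.PalmUnimodularRigidity
import Summits.AtomisticToContinuum.Crystallization.Theorems.DefectFreeCrystallizes.Negative.PredicateAPI
import Summits.AtomisticToContinuum.Crystallization.Theorems.ReggeStarCoercivityDefectFreeCrystallizesPalmDefs
import Summits.AtomisticToContinuum.Crystallization.Theorems.ReggeStarCoercivityDefectFreeCrystallizesGoodLaw
import Summits.AtomisticToContinuum.Crystallization.Theorems.ReggeStarCoercivityDefectFreeCrystallizesFunnelChart
import Summits.AtomisticToContinuum.Crystallization.Theorems.ReggeStarCoercivityDefectFreeCrystallizesChargeFromFunnelLaw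
import Summits.AtomisticToContinuum.Crystallization.Theorems.ReggeStarCoercivityDefectFreeCrystallizesRouteBetaFloor
import Summits.AtomisticToContinuum.Crystallization.Theorems.PalmUnimodularRigidityChargedPatternCrystallizes
import Summits.AtomisticToContinuum.Crystallization.Theorems.PalmUnimodularRigidityLayeredLawsSelectHcpDefs
import Summits.AtomisticToContinuum.Crystallization.Theorems.PalmUnimodularRigidityLayeredLawsSelectHcpRelaxedReference
import Summits.AtomisticToContinuum.Crystallization.Theorems.PalmUnimodularRigidityCruxesToPalmRigidity
import Summits.AtomisticToContinuum.Crystallization.Theorems.ExcessDecayLiouvilleCoarseGrainsHcpEnergySeries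
import Literature.Probability.Process.PointStationaryLaw
import Literature.MathematicalPhysics.StatisticalMechanics.BarlowStacking
import Literature.MathematicalPhysics.StatisticalMechanics.LennardJonesClusters
import Literature.Geometry.DiscreteGeometry.KissingPatterns
import Summits.AtomisticToContinuum.Crystallization.Theorems.ReggeStarCoercivityDefectFreeCrystallizesExactSelectionLawB
import Summits.AtomisticToContinuum.Crystallization.Theorems.ReggeStarCoercivityDefectFreeCrystallizesExactStarShortcutRigidityB

/-!
# The exact-star shortcut, first-shell form, II: the residue of crux `ReggeStarCoercivity.DefectFreeCrystallizes` WITHOUT item 3061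
# (line `palm-good-law`, lead c10, skeleton v33; item stmt-AtomisticToContinuum-13603)

Two reshapes of the residue left by lead c9 (`ExactStarShortcutGroundState.defectFreeCrystallizes_of_groundStateEquality : 3061 →
GROUND-STATE FUNNEL EQUALITY → crux`), both kernel-checked here:

1. **Item 3061 leaves the cone.**  It served only the level identity `hcpE a₀ h₀ = e*`.  That identity is free: after X2 the good limit
   law is a.s. an EXACT stacking `count|(A '' barlowStacking a₀ h s)`, whose root energy is `barlowSiteEnergy lennardJones a₀ h s 0 ≥ hcpE a₀ h₀`
   (the landed column of X3: `ExactSelectionLawB.selection_at_site`, `rootEnergy_reroot_eq_barlowSiteEnergy`); with the mean ceiling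
   `E_P[h] ≤ e* ≤ hcpE a₀ h₀` (`RouteBetaFloor.iInf_le_hcpE`) this forces integrability and `E_P[h] = hcpE a₀ h₀`, hence
   `hcpE a₀ h₀ ≤ e* ≤ hcpE a₀ h₀` (`level_and_hcp_of_stack`).
2. **The residue is first-shell only.**  The guard `μ{11/10 < ‖y‖ ≤ 5/4} = 0` of c9's form is replaced by `μ{11/10 < ‖y‖ < 6/5} = 0` (no
   thirteenth atom inside the bond radius), which is all X2 ever used (part I, `ExactStarShortcutRigidityB.stub_exactStarRigidityB`).

Result: `defectFreeCrystallizes_of_funnelEquality : GROUND-STATE FUNNEL EQUALITY (first-shell form, = the registered stub `stub_funnelEquality`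
of the skeleton v33 VERBATIM) → DefectFreeCrystallizes` — the crux is closed modulo ONE statement of its own, with no external item.  Also:
c9's v32 form still suffices (`defectFreeCrystallizes_of_funnelEqualityV32`, now without 3061), and the Palm route's TARGET item 9224
`PalmUnimodularRigidity.PalmRigidity` implies the crux by name (`defectFreeCrystallizes_of_palmRigidity`).  All `[folklore]`.
-/

noncomputable section

open scoped BigOperators ENNReal
open Filter Topology MeasureTheory

namespace Summit.AtomisticToContinuum.Crystallization.Theorems.PalmGoodLaw.ExactStarShortcutFirstShell

open Summit.AtomisticToContinuum.Crystallization.Theses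
open Summit.AtomisticToContinuum.Crystallization.Theses.ReggeStarCoercivity
open Summit.AtomisticToContinuum.Crystallization.Theorems.DefectFreeCrystallizes.Negative.PredicateAPI
open Literature.MathematicalPhysics.StatisticalMechanics Literature.Geometry.DiscreteGeometry
open Literature.Probability.Process
open Summit.AtomisticToContinuum.Crystallization.Theorems.PalmGoodLaw (SetGood)

section ExactStarGlue

open Summit.AtomisticToContinuum.Crystallization.Theorems.PalmUnimodularRigidity.LayeredLawsSelectHcp
  (hcpE hcpQ hcpSite hcpStarIdx rootStar starDefect starDefect_nonneg stub_relaxedReference)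
open Summit.AtomisticToContinuum.Crystallization.Theorems.PalmUnimodularRigidity
  (ae_forall_map_sub_of_ae count_restrict_floorNorm_preimage_lt_top)

/-- **The level is pinned by an a.s.-exact-stacking ground-state law, and the law is a.s. relaxed hcp** (lead c10; replaces item 3061 in
the composition of the line).  For the relaxed reference `(a₀, h₀)` and a point-stationary rooted hard-core probability law with `E_P[h] ≤ e*` that is
a.s. `count|(A '' barlowStacking a₀ h s)` with `h ∈ {h₀, a₀√(2/3)}`: `hcpE a₀ h₀ = e*` and a.s. `μ = count|(A '' hcpStacking a₀ h₀)`.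
Proof: the root energy of a sample is `barlowSiteEnergy … s 0 ≥ hcpE a₀ h₀` (landed column), the ceiling `E_P[h] ≤ e* ≤ hcpE a₀ h₀`
(`RouteBetaFloor.iInf_le_hcpE`) forces a.s. equality and integrability, so `E_P[h] = hcpE a₀ h₀ ≤ e*`; the hcp conclusion is X3. [folklore] -/
theorem level_and_hcp_of_stack {a₀ h₀ : ℝ} (ha₁ : 189 / 200 ≤ a₀) (ha₂ : a₀ ≤ 199 / 200) (hh₁ : 77 / 100 ≤ h₀)
    (hh₂ : h₀ ≤ 163 / 200) (hmin : ∀ a h : ℝ, 0 < a → 0 < h → hcpE a₀ h₀ ≤ hcpE a h)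
    {δ : ℝ} (hδ : 0 < δ) {P : Measure (Measure (EuclideanSpace ℝ (Fin 3)))} [hP : IsProbabilityMeasure P]
    (hcore : ∀ᵐ μ ∂P, IsRootedHardCore δ μ) (hstat : IsPointStationaryLaw P)
    (hE : (∫ μ, (∫ y, lennardJones ‖y‖ ∂μ) / 2 ∂P) ≤ (⨅ Q : PeriodicConfiguration 3, Q.energyPerParticle lennardJones))
    (hstack : ∀ᵐ μ ∂P, ∃ A : EuclideanSpace ℝ (Fin 3) ≃ₗᵢ[ℝ] EuclideanSpace ℝ (Fin 3), ∃ h : ℝ,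
      (h = h₀ ∨ h = a₀ * Real.sqrt (2 / 3)) ∧ ∃ s : ℤ → ℤ, IsHaggSeq s ∧
        μ = (Measure.count : Measure (EuclideanSpace ℝ (Fin 3))).restrict (A '' barlowStacking a₀ h s)) :
    hcpE a₀ h₀ = (⨅ Q : PeriodicConfiguration 3, Q.energyPerParticle lennardJones) ∧
      ∀ᵐ μ ∂P, ∃ A : EuclideanSpace ℝ (Fin 3) ≃ₗᵢ[ℝ] EuclideanSpace ℝ (Fin 3),
        μ = (Measure.count : Measure (EuclideanSpace ℝ (Fin 3))).restrict (A '' hcpStacking a₀ h₀) := by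
  have ha0 : 0 < a₀ := by linarith
  have hh0 : 0 < h₀ := by linarith
  have hstar : (⨅ Q : PeriodicConfiguration 3, Q.energyPerParticle lennardJones) ≤ hcpE a₀ h₀ :=
    Summit.AtomisticToContinuum.Crystallization.Theorems.PalmGoodLaw.RouteBetaFloor.iInf_le_hcpE ha0.ne' hh0.ne'
  have hlevel : (∫ μ, (∫ y, lennardJones ‖y‖ ∂μ) / 2 ∂P) ≤ hcpE a₀ h₀ := hE.trans hstar
  -- the root energy of a sample: the root `0 = A (barlowPos a₀ h s 0 0 0)` is an atom of layer `0`
  have hroot : ∀ (A : EuclideanSpace ℝ (Fin 3) ≃ₗᵢ[ℝ] EuclideanSpace ℝ (Fin 3)) {h : ℝ}, 0 < h →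
      ∀ s : ℤ → ℤ, (∫ z, lennardJones ‖z‖ ∂(Measure.count : Measure (EuclideanSpace ℝ (Fin 3))).restrict
        (A '' barlowStacking a₀ h s)) / 2 = barlowSiteEnergy lennardJones a₀ h s 0 := by
    intro A h hpos s
    have h1 := Summit.AtomisticToContinuum.Crystallization.Theorems.PalmGoodLaw.ExactSelectionLawB.rootEnergy_reroot_eq_barlowSiteEnergy
      ha0 hpos s A 0 0 0
    have h0 : barlowPos a₀ h s 0 0 0 = 0 := by simp [barlowPos]
    rw [h0, map_zero] at h1
    simpa only [sub_zero, Measure.map_id'] using h1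
  have hge : ∀ᵐ μ ∂P, hcpE a₀ h₀ ≤ (∫ y, lennardJones ‖y‖ ∂μ) / 2 := by
    filter_upwards [hstack] with μ hμ
    obtain ⟨A, h, hh, s, hs, rfl⟩ := hμ
    rw [hroot A (Summit.AtomisticToContinuum.Crystallization.Theorems.PalmGoodLaw.ExactSelectionLawB.column_box
      ha₁ ha₂ hh₁ hh₂ hmin hh).1 s]
    exact (Summit.AtomisticToContinuum.Crystallization.Theorems.PalmGoodLaw.ExactSelectionLawB.selection_at_site
      ha₁ ha₂ hh₁ hh₂ hmin hh hs 0).1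
  have hae : ∀ᵐ μ ∂P, (∫ y, lennardJones ‖y‖ ∂μ) / 2 = hcpE a₀ h₀ :=
    (Summit.AtomisticToContinuum.Crystallization.Theorems.PalmGoodLaw.ExactSelectionLawB.integrable_and_ae_eq_of_integral_le
      (Summit.AtomisticToContinuum.Crystallization.Theorems.PalmGoodLaw.ExactSelectionLawB.hcpE_le_neg_of_isMin hmin).2
      hge hlevel).2
  have hint : (∫ μ, (∫ y, lennardJones ‖y‖ ∂μ) / 2 ∂P) = hcpE a₀ h₀ := by
    rw [integral_congr_ae hae, integral_const, smul_eq_mul, probReal_univ, one_mul]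
  have heq : hcpE a₀ h₀ = ⨅ Q : PeriodicConfiguration 3, Q.energyPerParticle lennardJones :=
    le_antisymm (hint ▸ hE) hstar
  exact ⟨heq, Summit.AtomisticToContinuum.Crystallization.Theorems.PalmGoodLaw.ExactSelectionLawB.stub_exactSelectionLawB
    a₀ h₀ ha₁ ha₂ hh₁ hh₂ hmin δ hδ P hP hcore hstat hlevel hstack⟩

/-- **X2B + FUNNEL EQUALITY (v33) ⇒ funnel law rigidity, WITHOUT item 3061** (lead c10).  Chart the funnel (R1, landed), derive the
`e*`-level structure (a.s. force balance, zero mean stress: landed), get a.s. exact root stars with the first-shell guard (FUNNEL EQUALITY),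
move them to every atom (Aldous–Lyons), assemble an exact stacking (X2B), then `level_and_hcp_of_stack` pins `hcpE a₀ h₀ = e*` and gives
a.s. relaxed hcp (X3). [folklore] -/
theorem funnelLawRigidity_of_funnelEqualityB
    (hX2 :
        ∀ a₀ h₀ : ℝ, 189 / 200 ≤ a₀ → a₀ ≤ 199 / 200 → 77 / 100 ≤ h₀ → h₀ ≤ 163 / 200 →
          ∀ S : Set (EuclideanSpace ℝ (Fin 3)), (0 : EuclideanSpace ℝ (Fin 3)) ∈ S →
            (∀ y ∈ S, SetGood S y) →
            (∃ s : ℤ → ℤ, IsHaggSeq s ∧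
              ∃ Φ : EuclideanSpace ℝ (Fin 3) → EuclideanSpace ℝ (Fin 3),
                Set.BijOn Φ (barlowStacking 1 (Real.sqrt (2 / 3)) s) S ∧
                ∀ p ∈ barlowStacking 1 (Real.sqrt (2 / 3)) s, ∀ q ∈ barlowStacking 1 (Real.sqrt (2 / 3)) s,
                  (dist p q = 1 ↔ (0 < dist (Φ p) (Φ q) ∧ dist (Φ p) (Φ q) < 6 / 5))) →
            (∀ x ∈ S,
              (Summit.AtomisticToContinuum.Crystallization.Theorems.PalmUnimodularRigidity.LayeredLawsSelectHcp.starDefect a₀ h₀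
                  ((Measure.count : Measure (EuclideanSpace ℝ (Fin 3))).restrict ((fun z : EuclideanSpace ℝ (Fin 3) => z - x) '' S)) = 0 ∨
                (⨅ A : EuclideanSpace ℝ (Fin 3) ≃ₗᵢ[ℝ] EuclideanSpace ℝ (Fin 3),
                  ∑ p ∈ fccKissingPattern, Metric.infDist (A (a₀ • p))
                    (Summit.AtomisticToContinuum.Crystallization.Theorems.PalmUnimodularRigidity.LayeredLawsSelectHcp.rootStar
                      ((Measure.count : Measure (EuclideanSpace ℝ (Fin 3))).restrict ((fun z : EuclideanSpace ℝ (Fin 3) => z - x) '' S))) ^ 2) = 0) ∧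
              (Measure.count : Measure (EuclideanSpace ℝ (Fin 3))).restrict ((fun z : EuclideanSpace ℝ (Fin 3) => z - x) '' S)
                {y : EuclideanSpace ℝ (Fin 3) | 11 / 10 < ‖y‖ ∧ ‖y‖ < 6 / 5} = 0) →
            ∃ A : EuclideanSpace ℝ (Fin 3) ≃ₗᵢ[ℝ] EuclideanSpace ℝ (Fin 3), ∃ h : ℝ, (h = h₀ ∨ h = a₀ * Real.sqrt (2 / 3)) ∧
              ∃ s' : ℤ → ℤ, IsHaggSeq s' ∧ S = A '' barlowStacking a₀ h s')
    (hEQ :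
        ∀ a₀ h₀ : ℝ, 189 / 200 ≤ a₀ → a₀ ≤ 199 / 200 → 77 / 100 ≤ h₀ → h₀ ≤ 163 / 200 →
          (∀ a h : ℝ, 0 < a → 0 < h →
            Summit.AtomisticToContinuum.Crystallization.Theorems.PalmUnimodularRigidity.LayeredLawsSelectHcp.hcpE a₀ h₀ ≤
              Summit.AtomisticToContinuum.Crystallization.Theorems.PalmUnimodularRigidity.LayeredLawsSelectHcp.hcpE a h) →
          ∀ δ : ℝ, 0 < δ → ∀ P : Measure (Measure (EuclideanSpace ℝ (Fin 3))), IsProbabilityMeasure P →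
            (∀ᵐ μ ∂P, IsRootedHardCore δ μ) → IsPointStationaryLaw P →
            (∀ᵐ μ ∂P, ∃ S : Set (EuclideanSpace ℝ (Fin 3)),
              μ = (Measure.count : Measure (EuclideanSpace ℝ (Fin 3))).restrict S ∧
              (∀ y ∈ S, SetGood S y) ∧
              ∃ s : ℤ → ℤ, IsHaggSeq s ∧
                ∃ Φ : EuclideanSpace ℝ (Fin 3) → EuclideanSpace ℝ (Fin 3),
                  Set.BijOn Φ (barlowStacking 1 (Real.sqrt (2 / 3)) s) S ∧
                  ∀ p ∈ barlowStacking 1 (Real.sqrt (2 / 3)) s, ∀ q ∈ barlowStacking 1 (Real.sqrt (2 / 3)) s,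
                    (dist p q = 1 ↔ (0 < dist (Φ p) (Φ q) ∧ dist (Φ p) (Φ q) < 6 / 5))) →
            (∀ᵐ μ ∂P, ∃ S : Set (EuclideanSpace ℝ (Fin 3)),
              μ = (Measure.count : Measure (EuclideanSpace ℝ (Fin 3))).restrict S ∧
              ∀ p ∈ S, HasSum (fun q : {q : EuclideanSpace ℝ (Fin 3) // q ∈ S ∧ q ≠ p} =>
                (deriv lennardJones (dist p q.1) / dist p q.1) • (p - q.1)) 0) →
            (∀ M : EuclideanSpace ℝ (Fin 3) →L[ℝ] EuclideanSpace ℝ (Fin 3),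
              ∫ μ, (∫ y, deriv lennardJones ‖y‖ / ‖y‖ * inner ℝ y (M y) ∂μ) ∂P = 0) →
            (∫ μ, (∫ y, lennardJones ‖y‖ ∂μ) / 2 ∂P) ≤
              (⨅ Q : Literature.MathematicalPhysics.StatisticalMechanics.PeriodicConfiguration 3,
                Q.energyPerParticle Literature.MathematicalPhysics.StatisticalMechanics.lennardJones) →
            ∀ᵐ μ ∂P,
              (Summit.AtomisticToContinuum.Crystallization.Theorems.PalmUnimodularRigidity.LayeredLawsSelectHcp.starDefect a₀ h₀ μ = 0 ∨
                (⨅ A : EuclideanSpace ℝ (Fin 3) ≃ₗᵢ[ℝ] EuclideanSpace ℝ (Fin 3),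
                  ∑ p ∈ fccKissingPattern, Metric.infDist (A (a₀ • p))
                    (Summit.AtomisticToContinuum.Crystallization.Theorems.PalmUnimodularRigidity.LayeredLawsSelectHcp.rootStar μ) ^ 2) = 0) ∧
              μ {y : EuclideanSpace ℝ (Fin 3) | 11 / 10 < ‖y‖ ∧ ‖y‖ < 6 / 5} = 0) :
    ∀ δ : ℝ, 0 < δ → ∀ P : Measure (Measure (EuclideanSpace ℝ (Fin 3))), IsProbabilityMeasure P →
      (∀ᵐ μ ∂P, IsRootedHardCore δ μ) → IsPointStationaryLaw P →
      (∫ μ, (∫ y, lennardJones ‖y‖ ∂μ) / 2 ∂P) ≤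
        (⨅ Q : PeriodicConfiguration 3, Q.energyPerParticle lennardJones) →
      (∀ᵐ μ ∂P, ∃ S : Set (EuclideanSpace ℝ (Fin 3)),
        μ = (Measure.count : Measure (EuclideanSpace ℝ (Fin 3))).restrict S ∧ ∀ y ∈ S, SetGood S y) →
      ∀ᵐ μ ∂P, ∃ a h : ℝ, ∃ ha : a ≠ 0, ∃ hh : h ≠ 0, 1 / 2 ≤ a ∧ a ≤ 2 ∧ 1 / 2 ≤ h ∧ h ≤ 2 ∧
        ∃ A : EuclideanSpace ℝ (Fin 3) ≃ₗᵢ[ℝ] EuclideanSpace ℝ (Fin 3),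
          (hcpPeriodicConfiguration ha hh).energyPerParticle lennardJones =
            (⨅ Q : PeriodicConfiguration 3, Q.energyPerParticle lennardJones) ∧
          μ = (Measure.count : Measure (EuclideanSpace ℝ (Fin 3))).restrict (A '' hcpStacking a h) := by
  intro δ hδ P hP hcore hstat hE hgood
  -- R1 (landed): chart the funnel
  have hchart : ∀ᵐ μ ∂P, ∃ S : Set (EuclideanSpace ℝ (Fin 3)),
      μ = (Measure.count : Measure (EuclideanSpace ℝ (Fin 3))).restrict S ∧
      (∀ y ∈ S, SetGood S y) ∧
      ∃ s : ℤ → ℤ, IsHaggSeq s ∧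
        ∃ Φ : EuclideanSpace ℝ (Fin 3) → EuclideanSpace ℝ (Fin 3),
          Set.BijOn Φ (barlowStacking 1 (Real.sqrt (2 / 3)) s) S ∧
          ∀ p ∈ barlowStacking 1 (Real.sqrt (2 / 3)) s, ∀ q ∈ barlowStacking 1 (Real.sqrt (2 / 3)) s,
            (dist p q = 1 ↔ (0 < dist (Φ p) (Φ q) ∧ dist (Φ p) (Φ q) < 6 / 5)) := by
    filter_upwards [hcore, hgood] with μ hc hg
    obtain ⟨S, rfl, hS⟩ := hg
    obtain ⟨S₀, h0, -, hμ⟩ := hc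
    have h0S : (0 : EuclideanSpace ℝ (Fin 3)) ∈ S := by
      have h1 : (Measure.count : Measure (EuclideanSpace ℝ (Fin 3))).restrict S {0} ≠ 0 := by
        rw [hμ]
        exact (count_restrict_singleton_ne_zero_iff S₀ 0).2 h0
      exact (count_restrict_singleton_ne_zero_iff S 0).1 h1
    obtain ⟨s, hs, Φ, hΦ, hbond⟩ :=
      Summit.AtomisticToContinuum.Crystallization.Theorems.PalmGoodLaw.FunnelChart.stub_funnelChart S ⟨0, h0S⟩ hS
    exact ⟨S, rfl, hS, s, hs, Φ, hΦ, hbond⟩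
  -- the relaxed reference
  obtain ⟨a₀, h₀, ha₁, ha₂, hh₁, hh₂, hmin⟩ := stub_relaxedReference
  have ha0 : 0 < a₀ := by linarith
  have hh0 : 0 < h₀ := by linarith
  -- the `e*`-level structure of minimising laws (landed)
  have hFB := Summit.AtomisticToContinuum.Crystallization.Theorems.PalmGoodLaw.RouteBetaFloor.ae_forceBalance_of_minimising
    hδ hcore hstat hE
  have hZS := Summit.AtomisticToContinuum.Crystallization.Theorems.PalmGoodLaw.RouteBetaFloor.zeroMeanStress_of_minimising
    hδ hcore hstat hE
  -- FUNNEL EQUALITY: the ROOT star is a.s. exact, no thirteenth atom inside the bond radius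
  have hexact := hEQ a₀ h₀ ha₁ ha₂ hh₁ hh₂ hmin δ hδ P hP hcore hstat hchart hFB hZS hE
  -- every point a.s. (Aldous–Lyons; hard-core configurations are locally finite)
  have hlf : ∀ᵐ μ ∂P, ∀ n : ℕ,
      μ ((fun z : EuclideanSpace ℝ (Fin 3) => ⌊‖z‖⌋₊) ⁻¹' {n}) < ∞ := by
    filter_upwards [hcore] with μ hμ n
    obtain ⟨S, -, hsep, rfl⟩ := hμ
    exact count_restrict_floorNorm_preimage_lt_top hδ hsep n
  have hall := ae_forall_map_sub_of_ae hstat hlf hexact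
  -- X2B: a.s. an exact stacking
  have hstack : ∀ᵐ μ ∂P, ∃ A : EuclideanSpace ℝ (Fin 3) ≃ₗᵢ[ℝ] EuclideanSpace ℝ (Fin 3), ∃ h : ℝ,
      (h = h₀ ∨ h = a₀ * Real.sqrt (2 / 3)) ∧ ∃ s : ℤ → ℤ, IsHaggSeq s ∧
        μ = (Measure.count : Measure (EuclideanSpace ℝ (Fin 3))).restrict (A '' barlowStacking a₀ h s) := by
    filter_upwards [hcore, hchart, hall] with μ hc hch ha
    obtain ⟨S, hμS, hgoodS, hch'⟩ := hch
    obtain ⟨S₀, h0, -, hμ0⟩ := hc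
    have h0S : (0 : EuclideanSpace ℝ (Fin 3)) ∈ S := by
      have h1 : (Measure.count : Measure (EuclideanSpace ℝ (Fin 3))).restrict S {0} ≠ 0 := by
        rw [← hμS, hμ0]
        exact (count_restrict_singleton_ne_zero_iff S₀ 0).2 h0
      exact (count_restrict_singleton_ne_zero_iff S 0).1 h1
    have hx : ∀ x ∈ S,
        (starDefect a₀ h₀
            ((Measure.count : Measure (EuclideanSpace ℝ (Fin 3))).restrict
              ((fun z : EuclideanSpace ℝ (Fin 3) => z - x) '' S)) = 0 ∨
          (⨅ A : EuclideanSpace ℝ (Fin 3) ≃ₗᵢ[ℝ] EuclideanSpace ℝ (Fin 3),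
            ∑ p ∈ fccKissingPattern, Metric.infDist (A (a₀ • p))
              (rootStar ((Measure.count : Measure (EuclideanSpace ℝ (Fin 3))).restrict
                ((fun z : EuclideanSpace ℝ (Fin 3) => z - x) '' S))) ^ 2) = 0) ∧
        (Measure.count : Measure (EuclideanSpace ℝ (Fin 3))).restrict ((fun z : EuclideanSpace ℝ (Fin 3) => z - x) '' S)
          {y : EuclideanSpace ℝ (Fin 3) | 11 / 10 < ‖y‖ ∧ ‖y‖ < 6 / 5} = 0 := by
      intro x hxS
      have h1 := ha x (by rw [hμS]; exact (count_restrict_singleton_ne_zero_iff S x).2 hxS)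
      rwa [hμS, map_sub_count_restrict] at h1
    obtain ⟨A, h, hh, s', hs', hS⟩ := hX2 a₀ h₀ ha₁ ha₂ hh₁ hh₂ S h0S hgoodS hch' hx
    exact ⟨A, h, hh, s', hs', by rw [hμS, hS]⟩
  -- the level is pinned and the law is a.s. relaxed hcp (X3) — no item 3061
  obtain ⟨heq, hhcp⟩ := level_and_hcp_of_stack ha₁ ha₂ hh₁ hh₂ hmin hδ (hP := hP) hcore hstat hE hstack
  filter_upwards [hhcp] with μ hμ
  obtain ⟨A, hA⟩ := hμ
  refine ⟨a₀, h₀, ha0.ne', hh0.ne', by linarith, by linarith, by linarith, by linarith, A, ?_, hA⟩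
  rw [← heq]
  exact ((Summit.AtomisticToContinuum.Crystallization.Theorems.ExcessDecayLiouvilleCoarseGrains.hcpEnergySeries_of_eq
    a₀ h₀ ha0.ne' hh0.ne' hcpQ rfl).2.2)

/-- **The v32 form of FUNNEL EQUALITY (guard `≤ 5/4`) implies the v33 first-shell form (guard `< 6/5`)** — monotonicity of the guard
(`{11/10 < ‖y‖ < 6/5} ⊆ {11/10 < ‖y‖ ≤ 5/4}`); so every sufficient entry of v32 remains one. [folklore] -/
theorem funnelEquality_of_funnelEqualityV32
    (hV32 : ∀ a₀ h₀ : ℝ, 189 / 200 ≤ a₀ → a₀ ≤ 199 / 200 → 77 / 100 ≤ h₀ → h₀ ≤ 163 / 200 → (∀ a h : ℝ, 0 < a → 0 < h → Summit.AtomisticToContinuum.Crystallization.Theorems.PalmUnimodularRigidity.LayeredLawsSelectHcp.hcpE a₀ h₀ ≤ Summit.AtomisticToContinuum.Crystallization.Theorems.PalmUnimodularRigidity.LayeredLawsSelectHcp.hcpE a h) → ∀ δ : ℝ, 0 < δ → ∀ P : Measure (Measure (EuclideanSpace ℝ (Fin 3))), IsProbabilityMeasure P → (∀ᵐ μ ∂P,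 IsRootedHardCore δ μ) → IsPointStationaryLaw P → (∀ᵐ μ ∂P, ∃ S : Set (EuclideanSpace ℝ (Fin 3)), μ = (Measure.count : Measure (EuclideanSpace ℝ (Fin 3))).restrict S ∧ (∀ y ∈ S, SetGood S y) ∧ ∃ s : ℤ → ℤ, IsHaggSeq s ∧ ∃ Φ : EuclideanSpace ℝ (Fin 3) → EuclideanSpace ℝ (Fin 3), Set.BijOn Φ (barlowStacking 1 (Real.sqrt (2 / 3)) s) S ∧ ∀ p ∈ barlowStacking 1 (Real.sqrt (2 / 3)) s, ∀ q ∈ barlowStacking 1 (Real.sqrt (2 / 3)) s, (dist p q = 1 ↔ (0 < dist (Φ p) (Φ q) ∧ dist (Φ p) (Φ q) < 6 / 5))) → (∀ᵐ μ ∂P, ∃ S : Set (EuclideanSpace ℝ (Fin 3)), μ = (Measure.count : Measure (EuclideanSpace ℝ (Fin 3))).restrict S ∧ ∀ p ∈ S, HasSum (fun q : {q : EuclideanSpace ℝ (Fin 3) // q ∈ S ∧ q ≠ p} => (deriv lennardJones (dist p q.1) / dist p q.1) • (p - q.1)) 0) → (∀ M : EuclideanSpace ℝ (Fin 3) →L[ℝ]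 EuclideanSpace ℝ (Fin 3), ∫ μ, (∫ y, deriv lennardJones ‖y‖ / ‖y‖ * inner ℝ y (M y) ∂μ) ∂P = 0) → (∫ μ, (∫ y, lennardJones ‖y‖ ∂μ) / 2 ∂P) ≤ (⨅ Q : Literature.MathematicalPhysics.StatisticalMechanics.PeriodicConfiguration 3, Q.energyPerParticle Literature.MathematicalPhysics.StatisticalMechanics.lennardJones) → ∀ᵐ μ ∂P, (Summit.AtomisticToContinuum.Crystallization.Theorems.PalmUnimodularRigidity.LayeredLawsSelectHcp.starDefect a₀ h₀ μ = 0 ∨ (⨅ A : EuclideanSpace ℝ (Fin 3) ≃ₗᵢ[ℝ] EuclideanSpace ℝ (Fin 3), ∑ p ∈ fccKissingPattern, Metric.infDist (A (a₀ • p)) (Summit.AtomisticToContinuum.Crystallization.Theorems.PalmUnimodularRigidity.LayeredLawsSelectHcp.rootStar μ) ^ 2) = 0) ∧ μ {y : EuclideanSpace ℝ (Fin 3) | 11 / 10 < ‖y‖ ∧ ‖y‖ ≤ 5 / 4} = 0) :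
      ∀ a₀ h₀ : ℝ, 189 / 200 ≤ a₀ → a₀ ≤ 199 / 200 → 77 / 100 ≤ h₀ → h₀ ≤ 163 / 200 →
        (∀ a h : ℝ, 0 < a → 0 < h →
          Summit.AtomisticToContinuum.Crystallization.Theorems.PalmUnimodularRigidity.LayeredLawsSelectHcp.hcpE a₀ h₀ ≤
            Summit.AtomisticToContinuum.Crystallization.Theorems.PalmUnimodularRigidity.LayeredLawsSelectHcp.hcpE a h) →
        ∀ δ : ℝ, 0 < δ → ∀ P : Measure (Measure (EuclideanSpace ℝ (Fin 3))), IsProbabilityMeasure P →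
          (∀ᵐ μ ∂P, IsRootedHardCore δ μ) → IsPointStationaryLaw P →
          (∀ᵐ μ ∂P, ∃ S : Set (EuclideanSpace ℝ (Fin 3)),
            μ = (Measure.count : Measure (EuclideanSpace ℝ (Fin 3))).restrict S ∧
            (∀ y ∈ S, SetGood S y) ∧
            ∃ s : ℤ → ℤ, IsHaggSeq s ∧
              ∃ Φ : EuclideanSpace ℝ (Fin 3) → EuclideanSpace ℝ (Fin 3),
                Set.BijOn Φ (barlowStacking 1 (Real.sqrt (2 / 3)) s) S ∧
                ∀ p ∈ barlowStacking 1 (Real.sqrt (2 / 3)) s, ∀ q ∈ barlowStacking 1 (Real.sqrt (2 / 3)) s,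
                  (dist p q = 1 ↔ (0 < dist (Φ p) (Φ q) ∧ dist (Φ p) (Φ q) < 6 / 5))) →
          (∀ᵐ μ ∂P, ∃ S : Set (EuclideanSpace ℝ (Fin 3)),
            μ = (Measure.count : Measure (EuclideanSpace ℝ (Fin 3))).restrict S ∧
            ∀ p ∈ S, HasSum (fun q : {q : EuclideanSpace ℝ (Fin 3) // q ∈ S ∧ q ≠ p} =>
              (deriv lennardJones (dist p q.1) / dist p q.1) • (p - q.1)) 0) →
          (∀ M : EuclideanSpace ℝ (Fin 3) →L[ℝ] EuclideanSpace ℝ (Fin 3),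
            ∫ μ, (∫ y, deriv lennardJones ‖y‖ / ‖y‖ * inner ℝ y (M y) ∂μ) ∂P = 0) →
          (∫ μ, (∫ y, lennardJones ‖y‖ ∂μ) / 2 ∂P) ≤
            (⨅ Q : Literature.MathematicalPhysics.StatisticalMechanics.PeriodicConfiguration 3,
              Q.energyPerParticle Literature.MathematicalPhysics.StatisticalMechanics.lennardJones) →
          ∀ᵐ μ ∂P,
            (Summit.AtomisticToContinuum.Crystallization.Theorems.PalmUnimodularRigidity.LayeredLawsSelectHcp.starDefect a₀ h₀ μ = 0 ∨
              (⨅ A : EuclideanSpace ℝ (Fin 3) ≃ₗᵢ[ℝ] EuclideanSpace ℝ (Fin 3),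
                ∑ p ∈ fccKissingPattern, Metric.infDist (A (a₀ • p))
                  (Summit.AtomisticToContinuum.Crystallization.Theorems.PalmUnimodularRigidity.LayeredLawsSelectHcp.rootStar μ) ^ 2) = 0) ∧
            μ {y : EuclideanSpace ℝ (Fin 3) | 11 / 10 < ‖y‖ ∧ ‖y‖ < 6 / 5} = 0 := by
  intro a₀ h₀ ha₁ ha₂ hh₁ hh₂ hmin δ hδ P hP hhc hstat hchart hFB hZS hE
  filter_upwards [hV32 a₀ h₀ ha₁ ha₂ hh₁ hh₂ hmin δ hδ P hP hhc hstat hchart hFB hZS hE] with μ hμ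
  refine ⟨hμ.1, measure_mono_null (fun y hy => ?_) hμ.2⟩
  simp only [Set.mem_setOf_eq] at hy ⊢
  exact ⟨hy.1, by linarith [hy.2]⟩

/-- **THE RESIDUE OF CRUX 13603, FIRST-SHELL FORM, WITHOUT ITEM 3061 (lead c10, skeleton v33): GROUND-STATE FUNNEL EQUALITY proves
`DefectFreeCrystallizes`.**  The hypothesis is the registered stub `stub_funnelEquality` of `Lines/palm_good_law.lean` v33 VERBATIM: for the
relaxed reference `(a₀, h₀)` and every hard core `δ > 0`, a point-stationary rooted `δ`-hard-core probability law a.s. carried by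
everywhere-`SetGood` Barlow-charted (bond window `(0, 6/5)`) force-balanced configurations, with zero mean virial stress and `E_P[h] ≤ e*`, has
a.s. an exact root star (relaxed-hcp OR regular-fcc type) and no thirteenth atom inside the bond radius.  Glue-by anchor
`defectFreeCrystallizes_of_funnelEquality` (P1 `stub_goodLaw`, R3 `stub_chargeFromFunnelLaw`, item 2916 `chargedPatternCrystallizes_proof`,
`LennardJonesMinimalDistance_holds`, all landed). [folklore] -/
theorem defectFreeCrystallizes_of_funnelEquality :
    (∀ a₀ h₀ : ℝ, 189 / 200 ≤ a₀ → a₀ ≤ 199 / 200 → 77 / 100 ≤ h₀ → h₀ ≤ 163 / 200 → (∀ a h : ℝ, 0 < a → 0 < h → Summit.AtomisticToContinuum.Crystallization.Theorems.PalmUnimodularRigidity.LayeredLawsSelectHcp.hcpE a₀ h₀ ≤ Summit.AtomisticToContinuum.Crystallization.Theorems.PalmUnimodularRigidity.LayeredLawsSelectHcp.hcpE a h) → ∀ δ : ℝ, 0 < δ → ∀ P : Measure (Measure (EuclideanSpace ℝ (Fin 3))), IsProbabilityMeasure P → (∀ᵐ μ ∂P, IsRootedHardCore δ μ) → IsPointStationaryLaw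 P → (∀ᵐ μ ∂P, ∃ S : Set (EuclideanSpace ℝ (Fin 3)), μ = (Measure.count : Measure (EuclideanSpace ℝ (Fin 3))).restrict S ∧ (∀ y ∈ S, SetGood S y) ∧ ∃ s : ℤ → ℤ, IsHaggSeq s ∧ ∃ Φ : EuclideanSpace ℝ (Fin 3) → EuclideanSpace ℝ (Fin 3), Set.BijOn Φ (barlowStacking 1 (Real.sqrt (2 / 3)) s) S ∧ ∀ p ∈ barlowStacking 1 (Real.sqrt (2 / 3)) s, ∀ q ∈ barlowStacking 1 (Real.sqrt (2 / 3)) s, (dist p q = 1 ↔ (0 < dist (Φ p) (Φ q) ∧ dist (Φ p) (Φ q) < 6 / 5))) → (∀ᵐ μ ∂P, ∃ S : Set (EuclideanSpace ℝ (Fin 3)), μ = (Measure.count : Measure (EuclideanSpace ℝ (Fin 3))).restrict S ∧ ∀ p ∈ S, HasSum (fun q : {q : EuclideanSpace ℝ (Fin 3) // q ∈ S ∧ q ≠ p} => (deriv lennardJones (dist p q.1) / dist p q.1) • (p - q.1)) 0) → (∀ M : EuclideanSpace ℝ (Fin 3) →L[ℝ] EuclideanSpace ℝ (Fin 3), ∫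 μ, (∫ y, deriv lennardJones ‖y‖ / ‖y‖ * inner ℝ y (M y) ∂μ) ∂P = 0) → (∫ μ, (∫ y, lennardJones ‖y‖ ∂μ) / 2 ∂P) ≤ (⨅ Q : Literature.MathematicalPhysics.StatisticalMechanics.PeriodicConfiguration 3, Q.energyPerParticle Literature.MathematicalPhysics.StatisticalMechanics.lennardJones) → ∀ᵐ μ ∂P, (Summit.AtomisticToContinuum.Crystallization.Theorems.PalmUnimodularRigidity.LayeredLawsSelectHcp.starDefect a₀ h₀ μ = 0 ∨ (⨅ A : EuclideanSpace ℝ (Fin 3) ≃ₗᵢ[ℝ] EuclideanSpace ℝ (Fin 3), ∑ p ∈ fccKissingPattern, Metric.infDist (A (a₀ • p)) (Summit.AtomisticToContinuum.Crystallization.Theorems.PalmUnimodularRigidity.LayeredLawsSelectHcp.rootStar μ) ^ 2) = 0) ∧ μ {y : EuclideanSpace ℝ (Fin 3) | 11 / 10 < ‖y‖ ∧ ‖y‖ < 6 / 5} = 0) →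
    Summit.AtomisticToContinuum.Crystallization.Theses.ReggeStarCoercivity.DefectFreeCrystallizes := fun hEQ =>
  defectFreeCrystallizes_iff.2 fun hZ =>
    Summit.AtomisticToContinuum.Crystallization.Theorems.chargedPatternCrystallizes_proof
      (Summit.AtomisticToContinuum.Crystallization.Theorems.PalmGoodLaw.ChargeFromFunnelLaw.stub_chargeFromFunnelLaw
        Summit.AtomisticToContinuum.Crystallization.Theorems.PalmGoodLaw.stub_goodLaw
        (funnelLawRigidity_of_funnelEqualityB ExactStarShortcutRigidityB.stub_exactStarRigidityB hEQ) hZ)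
      LennardJonesMinimalDistance_holds

/-- **Lead c9's v32 form (guard `≤ 5/4`) proves the crux WITHOUT item 3061** (compare
`ExactStarShortcutGroundState.defectFreeCrystallizes_of_groundStateEquality : 3061 → v32 form → crux`). [folklore] -/
theorem defectFreeCrystallizes_of_funnelEqualityV32
    (hV32 : ∀ a₀ h₀ : ℝ, 189 / 200 ≤ a₀ → a₀ ≤ 199 / 200 → 77 / 100 ≤ h₀ → h₀ ≤ 163 / 200 → (∀ a h : ℝ, 0 < a → 0 < h → Summit.AtomisticToContinuum.Crystallization.Theorems.PalmUnimodularRigidity.LayeredLawsSelectHcp.hcpE a₀ h₀ ≤ Summit.AtomisticToContinuum.Crystallization.Theorems.PalmUnimodularRigidity.LayeredLawsSelectHcp.hcpE a h) → ∀ δ : ℝ, 0 < δ → ∀ P : Measure (Measure (EuclideanSpace ℝ (Fin 3))), IsProbabilityMeasure P → (∀ᵐ μ ∂P, IsRootedHardCore δ μ) → IsPointStationaryLaw P → (∀ᵐ μ ∂P, ∃ S : Set (EuclideanSpace ℝ (Fin 3)), μ = (Measure.count : Measure (EuclideanSpace ℝ (Fin 3))).restrict S ∧ (∀ y ∈ S,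 SetGood S y) ∧ ∃ s : ℤ → ℤ, IsHaggSeq s ∧ ∃ Φ : EuclideanSpace ℝ (Fin 3) → EuclideanSpace ℝ (Fin 3), Set.BijOn Φ (barlowStacking 1 (Real.sqrt (2 / 3)) s) S ∧ ∀ p ∈ barlowStacking 1 (Real.sqrt (2 / 3)) s, ∀ q ∈ barlowStacking 1 (Real.sqrt (2 / 3)) s, (dist p q = 1 ↔ (0 < dist (Φ p) (Φ q) ∧ dist (Φ p) (Φ q) < 6 / 5))) → (∀ᵐ μ ∂P, ∃ S : Set (EuclideanSpace ℝ (Fin 3)), μ = (Measure.count : Measure (EuclideanSpace ℝ (Fin 3))).restrict S ∧ ∀ p ∈ S, HasSum (fun q : {q : EuclideanSpace ℝ (Fin 3) // q ∈ S ∧ q ≠ p} => (deriv lennardJones (dist p q.1) / dist p q.1) • (p - q.1)) 0) → (∀ M : EuclideanSpace ℝ (Fin 3) →L[ℝ] EuclideanSpace ℝ (Fin 3), ∫ μ, (∫ y, deriv lennardJones ‖y‖ / ‖y‖ * inner ℝ y (M y) ∂μ) ∂P = 0) → (∫ μ, (∫ y, lennardJones ‖y‖ ∂μ) / 2 ∂P)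 ≤ (⨅ Q : Literature.MathematicalPhysics.StatisticalMechanics.PeriodicConfiguration 3, Q.energyPerParticle Literature.MathematicalPhysics.StatisticalMechanics.lennardJones) → ∀ᵐ μ ∂P, (Summit.AtomisticToContinuum.Crystallization.Theorems.PalmUnimodularRigidity.LayeredLawsSelectHcp.starDefect a₀ h₀ μ = 0 ∨ (⨅ A : EuclideanSpace ℝ (Fin 3) ≃ₗᵢ[ℝ] EuclideanSpace ℝ (Fin 3), ∑ p ∈ fccKissingPattern, Metric.infDist (A (a₀ • p)) (Summit.AtomisticToContinuum.Crystallization.Theorems.PalmUnimodularRigidity.LayeredLawsSelectHcp.rootStar μ) ^ 2) = 0) ∧ μ {y : EuclideanSpace ℝ (Fin 3) | 11 / 10 < ‖y‖ ∧ ‖y‖ ≤ 5 / 4} = 0) :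
    Summit.AtomisticToContinuum.Crystallization.Theses.ReggeStarCoercivity.DefectFreeCrystallizes :=
  defectFreeCrystallizes_of_funnelEquality (funnelEquality_of_funnelEqualityV32 hV32)

/-- **Item 9224 `PalmUnimodularRigidity.PalmRigidity` gives funnel law rigidity verbatim** (its hypotheses `∃ S, 0 ∈ S ∧ separated ∧
μ = count|S` and the Mecke identity ARE `IsRootedHardCore δ μ` / `IsPointStationaryLaw P` by `Iff.rfl`; the funnel hypothesis is not even
used). [folklore] -/
theorem funnelLawRigidity_of_palmRigidity (h9224 : PalmUnimodularRigidity.PalmRigidity) :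
    ∀ δ : ℝ, 0 < δ → ∀ P : Measure (Measure (EuclideanSpace ℝ (Fin 3))), IsProbabilityMeasure P →
      (∀ᵐ μ ∂P, IsRootedHardCore δ μ) → IsPointStationaryLaw P →
      (∫ μ, (∫ y, lennardJones ‖y‖ ∂μ) / 2 ∂P) ≤
        (⨅ Q : PeriodicConfiguration 3, Q.energyPerParticle lennardJones) →
      (∀ᵐ μ ∂P, ∃ S : Set (EuclideanSpace ℝ (Fin 3)),
        μ = (Measure.count : Measure (EuclideanSpace ℝ (Fin 3))).restrict S ∧ ∀ y ∈ S, SetGood S y) →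
      ∀ᵐ μ ∂P, ∃ a h : ℝ, ∃ ha : a ≠ 0, ∃ hh : h ≠ 0, 1 / 2 ≤ a ∧ a ≤ 2 ∧ 1 / 2 ≤ h ∧ h ≤ 2 ∧
        ∃ A : EuclideanSpace ℝ (Fin 3) ≃ₗᵢ[ℝ] EuclideanSpace ℝ (Fin 3),
          (hcpPeriodicConfiguration ha hh).energyPerParticle lennardJones =
            (⨅ Q : PeriodicConfiguration 3, Q.energyPerParticle lennardJones) ∧
          μ = (Measure.count : Measure (EuclideanSpace ℝ (Fin 3))).restrict (A '' hcpStacking a h) :=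
  fun δ hδ P hP hcore hstat hE _ => h9224 δ hδ P hP hcore hstat hE

/-- **13603 ≤ 9224 by name (lead c10)** — the Palm route's TARGET `PalmRigidity` implies `DefectFreeCrystallizes` (through the
landed P1 `stub_goodLaw`, R3 `stub_chargeFromFunnelLaw`, item 2916 `chargedPatternCrystallizes_proof`). [folklore] -/
theorem defectFreeCrystallizes_of_palmRigidity (h9224 : PalmUnimodularRigidity.PalmRigidity) :
    Summit.AtomisticToContinuum.Crystallization.Theses.ReggeStarCoercivity.DefectFreeCrystallizes :=
  defectFreeCrystallizes_iff.2 fun hZ =>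
    Summit.AtomisticToContinuum.Crystallization.Theorems.chargedPatternCrystallizes_proof
      (Summit.AtomisticToContinuum.Crystallization.Theorems.PalmGoodLaw.ChargeFromFunnelLaw.stub_chargeFromFunnelLaw
        Summit.AtomisticToContinuum.Crystallization.Theorems.PalmGoodLaw.stub_goodLaw
        (funnelLawRigidity_of_palmRigidity h9224) hZ)
      LennardJonesMinimalDistance_holds

end ExactStarGlue

end Summit.AtomisticToContinuum.Crystallization.Theorems.PalmGoodLaw.ExactStarShortcutFirstShell

end
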